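import Literature.Probability.Percolation.CornerPercolation
import Literature.Probability.Percolation.HalfPlaneUCatch
import Literature.Probability.Percolation.Chaining
import HarnessLib

/-!
# Stub `stub_local` (crux stmt-CriticalPhenomena-5476 `UniformBoxCrossing`, line `Sketch`,
# v4 microcanonical composition): locality of the two turned crossing events

Worker file. The theorem name, namespace, `open` lines and the statement text are EXACTLY those
registered by the lead's skeleton (`work/UniformBoxCrossing.lean`); helper lemmas are `private`.

For the u-crossing event `U(A, B, m) = embTBCrossing (zDia · - (A + B i)) m (2m)` of the turned
`m × 2m` box at `(A, B)` and the w-crossing event `W(A, B, m) = embRectCrossing (…) (2m) m` of the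
turned `2m × m` box (diamond coordinates `col = x₀ - x₁`, `hgt = x₀ + x₁` of `ℤ²`, drawing `zDia`):

* the vertex region of the event is a finite subset of `ℤ²`: since `re (zDia v - (A + B i)) =
  col v - A` and `im (…) = hgt v - B` (`re_zDia_sub_int`, `im_zDia_sub_int`), the real-coordinate
  region `{0 ≤ re ≤ m} × {-2 ≤ im ≤ 2m + 2}` is the integer box
  `{A ≤ col ≤ A + m} × {B - 2 ≤ hgt ≤ B + 2m + 2}`, finite because `v ↦ (col v, hgt v)` is
  injective (`HalfPlaneArm.box_finite`);
* the event is measurable (`HalfPlaneArm.measurableSet_openCrossing_of_finite`);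
* its coin-space form `{S | cornerConfig S ∈ event}` is determined by the coins `(v, j)`,
  `j ∈ {0, 1}`, of the vertices `v` of the region: the event only looks at the pairs with both
  endpoints in the region (`HalfPlaneArm.determinedBy_openCrossing_of_finite`), every open pair of
  `cornerConfig S` is a lattice edge `{v, v + e_j}` whose state reads the two bits of its base
  vertex `v` only (`mem_cornerConfig_iff`), and `v` lies in the region.
-/

namespace Summit.CriticalPhenomena.CardyFormulaZ2.Cruxes.UniformBoxCrossing.Microcanonical

open MeasureTheory Complex Literature.Probability.Percolation Literature.Probability.LatticeModels
open Literature.Probability.Percolation.TrackExchange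

/-- A site of `ℤ²` is determined by its diamond coordinates `(col, hgt) = (x₀ - x₁, x₀ + x₁)`. -/
private theorem colHgt_injective : Function.Injective fun v : Site 2 => (col v, hgtOf v) := by
  -- adapted from `HalfPlaneArm.diag_injective` (HalfPlaneArmDiagonalInputs.lean)
  intro v w h
  simp only [Prod.mk.injEq, col, hgtOf] at h
  funext i
  fin_cases i
  · show v 0 = w 0
    omega
  · show v 1 = w 1
    omega

/-- A box in the diamond coordinates contains finitely many sites. -/
private theorem diamondBox_finite (A₁ A₂ B₁ B₂ : ℤ) :
    {v : Site 2 | A₁ ≤ col v ∧ col v ≤ A₂ ∧ B₁ ≤ hgtOf v ∧ hgtOf v ≤ B₂}.Finite :=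
  HalfPlaneArm.box_finite (X := col) (Y := hgtOf) colHgt_injective A₁ A₂ B₁ B₂

/-- The real-coordinate region of the u-crossing event of the turned `m × 2m` box at `(A, B)` is
the integer box `{A ≤ col ≤ A + m} × {B - 2 ≤ hgt ≤ B + 2m + 2}`. -/
private theorem regionTB_eq (A B : ℤ) (m : ℕ) :
    {v : Site 2 | (zDia v - ((A : ℂ) + (B : ℂ) * I)).re ∈ Set.Icc (0 : ℝ) (m : ℝ) ∧
        (zDia v - ((A : ℂ) + (B : ℂ) * I)).im ∈ Set.Icc (-2 : ℝ) (2 * (m : ℝ) + 2)} =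
      {v : Site 2 | A ≤ col v ∧ col v ≤ A + m ∧ B - 2 ≤ hgtOf v ∧ hgtOf v ≤ B + 2 * m + 2} := by
  ext v
  simp only [Set.mem_setOf_eq, Set.mem_Icc, re_zDia_sub_int, im_zDia_sub_int]
  constructor
  · rintro ⟨⟨h1, h2⟩, h3, h4⟩
    refine ⟨?_, ?_, ?_, ?_⟩
    · exact_mod_cast (by linarith : (A : ℝ) ≤ col v)
    · exact_mod_cast (by linarith : (col v : ℝ) ≤ A + m)
    · exact_mod_cast (by linarith : (B : ℝ) - 2 ≤ hgtOf v)
    · exact_mod_cast (by linarith : (hgtOf v : ℝ) ≤ B + 2 * m + 2)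
  · rintro ⟨h1, h2, h3, h4⟩
    have h1' : (A : ℝ) ≤ col v := by exact_mod_cast h1
    have h2' : (col v : ℝ) ≤ A + m := by exact_mod_cast h2
    have h3' : (B : ℝ) - 2 ≤ hgtOf v := by exact_mod_cast h3
    have h4' : (hgtOf v : ℝ) ≤ B + 2 * m + 2 := by exact_mod_cast h4
    exact ⟨⟨by linarith, by linarith⟩, by linarith, by linarith⟩

/-- The real-coordinate region of the w-crossing event of the turned `2m × m` box at `(A, B)` is
the integer box `{A - 2 ≤ col ≤ A + 2m + 2} × {B ≤ hgt ≤ B + m}`. -/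
private theorem regionLR_eq (A B : ℤ) (m : ℕ) :
    {v : Site 2 | (zDia v - ((A : ℂ) + (B : ℂ) * I)).re ∈ Set.Icc (-2 : ℝ) (2 * (m : ℝ) + 2) ∧
        (zDia v - ((A : ℂ) + (B : ℂ) * I)).im ∈ Set.Icc (0 : ℝ) (m : ℝ)} =
      {v : Site 2 | A - 2 ≤ col v ∧ col v ≤ A + 2 * m + 2 ∧ B ≤ hgtOf v ∧ hgtOf v ≤ B + m} := by
  ext v
  simp only [Set.mem_setOf_eq, Set.mem_Icc, re_zDia_sub_int, im_zDia_sub_int]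
  constructor
  · rintro ⟨⟨h1, h2⟩, h3, h4⟩
    refine ⟨?_, ?_, ?_, ?_⟩
    · exact_mod_cast (by linarith : (A : ℝ) - 2 ≤ col v)
    · exact_mod_cast (by linarith : (col v : ℝ) ≤ A + 2 * m + 2)
    · exact_mod_cast (by linarith : (B : ℝ) ≤ hgtOf v)
    · exact_mod_cast (by linarith : (hgtOf v : ℝ) ≤ B + m)
  · rintro ⟨h1, h2, h3, h4⟩
    have h1' : (A : ℝ) - 2 ≤ col v := by exact_mod_cast h1
    have h2' : (col v : ℝ) ≤ A + 2 * m + 2 := by exact_mod_cast h2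
    have h3' : (B : ℝ) ≤ hgtOf v := by exact_mod_cast h3
    have h4' : (hgtOf v : ℝ) ≤ B + m := by exact_mod_cast h4
    exact ⟨⟨by linarith, by linarith⟩, by linarith, by linarith⟩

/-- From bond-space to coin-space locality: if an event `E` of bond configurations of `ℤ²` is
determined by the pairs with both endpoints in `R`, then `{S | cornerConfig S ∈ E}` is determined
by the coins and splitting bits of the vertices of `R` — every open pair of `cornerConfig S` is an
edge `{v, v + e_j}` whose state reads the bits `(v, 0)`, `(v, 1)` of its base vertex `v ∈ R` only
(`mem_cornerConfig_iff`). -/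
private theorem determinedBy_coin_of_bond {E : Set (BondConfig (Site 2))} {R : Set (Site 2)}
    (hE : DeterminedBy E {e : Sym2 (Site 2) | ∀ x ∈ e, x ∈ R}) :
    DeterminedBy {S : Set (Site 2 × Fin 2) | cornerConfig S ∈ E}
      (R ×ˢ (Set.univ : Set (Fin 2))) := by
  -- adapted from `determinedBy_coinEvent`
  -- (Theorems/CardySelfDualSegmentSegmentOpenStubCrossingProbPolynomial.lean)
  rw [determinedBy_iff] at hE ⊢
  intro S S' hSS'
  -- the two coin sets agree on the bits of the vertices of `R`
  have hcoin : ∀ v ∈ R, ∀ j : Fin 2, ((v, j) ∈ S ↔ (v, j) ∈ S') := by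
    intro v hv j
    have hmem : (v, j) ∈ R ×ˢ (Set.univ : Set (Fin 2)) := Set.mk_mem_prod hv (Set.mem_univ _)
    exact ⟨fun h => ((Set.ext_iff.1 hSS' (v, j)).1 ⟨h, hmem⟩).1,
      fun h => ((Set.ext_iff.1 hSS' (v, j)).2 ⟨h, hmem⟩).1⟩
  -- hence the two corner configurations agree on the pairs with both members in `R`
  refine hE (cornerConfig S) (cornerConfig S') ?_
  ext e
  refine and_congr_left fun he => ?_
  rw [mem_cornerConfig_iff, mem_cornerConfig_iff]
  refine exists_congr fun v => or_congr (and_congr_right fun hev => ?_)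
    (and_congr_right fun hev => ?_)
  · exact hcoin v (he v (hev ▸ Sym2.mem_mk_left _ _)) 0
  · have hv : v ∈ R := he v (hev ▸ Sym2.mem_mk_left _ _)
    exact iff_congr (hcoin v hv 0) (not_congr (hcoin v hv 1))

/-- **Stub C (provable): locality of the two turned crossing events.** The u-crossing event of
the turned `m × 2m` box at `(A, B)` and the w-crossing event of the turned `2m × m` box are
measurable, their vertex regions (in diamond coordinates `col = x₀ - x₁`, `hgt = x₀ + x₁`) are
finite, and their coin-space forms are determined by the coins of the vertices of the region (an
open crossing inside a finite region only looks at lattice edges with both endpoints in the region,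
`HalfPlaneArm.determinedBy_openCrossing_of_finite`, and the edge `{v, v + e_j}` of `cornerConfig S`
reads the two bits of `v` only, `mem_cornerConfig_iff`; cf. `determinedBy_coinEvent` in
`Theorems/CardySelfDualSegmentSegmentOpenStubCrossingProbPolynomial.lean`). -/
theorem stub_local :
    (∀ (A B : ℤ) (m : ℕ),
      {v : Site 2 | A ≤ col v ∧ col v ≤ A + m ∧ B - 2 ≤ hgtOf v ∧ hgtOf v ≤ B + 2 * m + 2}.Finite ∧
      MeasurableSet (embTBCrossing (fun v => zDia v - ((A : ℂ) + (B : ℂ) * I)) m (2 * m)) ∧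
      DeterminedBy
        {S : Set (Site 2 × Fin 2) |
          cornerConfig S ∈ embTBCrossing (fun v => zDia v - ((A : ℂ) + (B : ℂ) * I)) m (2 * m)}
        ({v : Site 2 | A ≤ col v ∧ col v ≤ A + m ∧ B - 2 ≤ hgtOf v ∧ hgtOf v ≤ B + 2 * m + 2} ×ˢ
          (Set.univ : Set (Fin 2)))) ∧
    (∀ (A B : ℤ) (m : ℕ),
      {v : Site 2 | A - 2 ≤ col v ∧ col v ≤ A + 2 * m + 2 ∧ B ≤ hgtOf v ∧ hgtOf v ≤ B + m}.Finite ∧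
      MeasurableSet (embRectCrossing (fun v => zDia v - ((A : ℂ) + (B : ℂ) * I)) (2 * m) m) ∧
      DeterminedBy
        {S : Set (Site 2 × Fin 2) |
          cornerConfig S ∈ embRectCrossing (fun v => zDia v - ((A : ℂ) + (B : ℂ) * I)) (2 * m) m}
        ({v : Site 2 | A - 2 ≤ col v ∧ col v ≤ A + 2 * m + 2 ∧ B ≤ hgtOf v ∧ hgtOf v ≤ B + m} ×ˢ
          (Set.univ : Set (Fin 2)))) := by
  refine ⟨fun A B m => ?_, fun A B m => ?_⟩
  · have hfin := diamondBox_finite A (A + m) (B - 2) (B + 2 * m + 2)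
    dsimp only [embTBCrossing]
    rw [regionTB_eq A B m]
    exact ⟨hfin, HalfPlaneArm.measurableSet_openCrossing_of_finite hfin _ _,
      determinedBy_coin_of_bond (HalfPlaneArm.determinedBy_openCrossing_of_finite hfin _ _)⟩
  · have hfin := diamondBox_finite (A - 2) (A + 2 * m + 2) B (B + m)
    dsimp only [embRectCrossing]
    rw [regionLR_eq A B m]
    exact ⟨hfin, HalfPlaneArm.measurableSet_openCrossing_of_finite hfin _ _,
      determinedBy_coin_of_bond (HalfPlaneArm.determinedBy_openCrossing_of_finite hfin _ _)⟩

end Summit.CriticalPhenomena.CardyFormulaZ2.Cruxes.UniformBoxCrossing.Microcanonical
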